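import Mathlib.FieldTheory.IsAlgClosed.AlgebraicClosure
import Literature.IUT.HodgeTheaters.CriticalLocusOfTwoTorsion
import Literature.IUT.HodgeTheaters.InitialThetaDataLegendreProofs
import HarnessLib

/-!
# [IUTchI] Rmk 3.1.7 (i) at the datum: the GEOMETRIC strictly critical locus, and its transport

S. Mochizuki, *Inter-universal Teichmüller theory I*, §3, Remark 3.1.7 (i) (kurims final manuscript
May 2020, p. 66) and Definition 3.1 (a)(b) (p. 61) [claim: Mochizuki2012, status: disputed].
Cell `abc-iut`, GAP B (G-L5t9g8-1: the `∞κ`-compatibility clause of [IUTchI] Ex. 5.4 (iv)), item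
**GB-04** = memo `GAP-SIZING-B.md` §2 row D1 (R4 half) «genuine strictly-critical locus of `C_{F_mod}`
(the `x`-coordinates of `E[2]`) over `Ω := F̄` — ABSENT», supplied here as named `def`s.

**Print (Rmk 3.1.7 (i)).** `|C_L|^cpt ≅ ℙ¹_L` has "precisely `4` critical points", the images of the
`2`-torsion of `E_F`: the cusp (image of the origin) and `3` *strictly critical* points. In the
coordinate `t := x` of a Weierstrass model `E` (the quotient `E → E/{±1} ≅ ℙ¹` is `(x, y) ↦ x`, so
the cusp is `x = ∞` — the convention of `KappaCoricFunctions.lean`) the strictly critical points are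
the abscissae of the three points of order `2`, i.e. the roots of the `2`-division cubic
`4x³ + b₂x² + 2b₄x + b₆` (Mathlib `WeierstrassCurve.twoTorsionPolynomial`), three of them since its
discriminant is `16·Δ_E ≠ 0` (`twoTorsionPolynomial_discr_ne_zero_of_isElliptic`,
`Cubic.card_roots_of_discr_ne_zero`).

**Why geometric.** RULINGS #318 (ERRATA I-124) / memo §3 R1, R4: `CriticalLocus.IsKappaCoric`
counts zeroes/poles IN the parameter field `Ω` (`KappaCoricFunctions.lean` :69/:73) — base-change
stable only for `Ω` algebraically closed (print's divisors are geometric, over `L̄`); so the producer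
reads the locus in an ALGEBRAICALLY CLOSED `Ω ⊇ F` (`F̄`; `K̄_v`) and transports it along `F̄ ↪ Ω'`.

## Contents (sorry-free; no instance / notation / new axiom)

* §1 `CriticalLocus.critMap S φ` — transport along a field hom (the signature pinned in
  abc-iut-inv-2's `GapSizingBSketch.lean` :41), functorial, with membership lemmas.
* §2 `CriticalLocus.ofTwoTorsionOfSplits E φ hs` (char `F ≠ 2`, the cubic splits along
  `φ : F →+* Ω`) and `CriticalLocus.ofTwoTorsion E Ω` (`Ω ⊇ F` algebraically closed), with
  `coe_pts_ofTwoTorsion` (`= rootSet`; so the `∃`-theorems of the landed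
  `CriticalLocusOfTwoTorsion.lean` speak about THIS locus, `eq_ofTwoTorsion_of_coe_pts_eq`), the
  printed equation, algebraicity over `ℚ`, NATURALITY `critMap_ofTwoTorsion` (transport `Ω → Ω'`
  over `F` lands on the locus at `Ω'` — the target `critMap S B.φ` of the geometric clause (a)
  `ClauseAGeom`).
* §3 at initial Θ-data `D : InitialThetaData F K Fbar E l P` ([IUTchI] Def. 3.1; the structure's
  PARAMETERS `F`, `E`, `Fbar` are print's `F`, `E_F`, `F̄`): by Def. 3.1 (b) the cubic SPLITS OVER
  `F` (`twoTorsionPolynomial_splits`, from the landed `exists_twoTorsion_roots`), so the locus lives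
  over `F` (`D.critLocus`) and is read in any field over `F` by transport (`D.critLocusAt Ω`). The
  RULED decl (GAP-ITEMS.tsv row GB-04) `D.critLocusGeom : CriticalLocus Fbar` is the reading in the
  datum's OWN `F̄ = Fbar` (Def. 3.1 (a), the carrier of `G_F = Fbar ≃ₐ[F] Fbar`; L-of-record `Fbar` per
  the GAP-B spec-keeper's PIN L, cell STATUS 2026-08-28T20:50:28Z), `:= ofTwoTorsion E Fbar`, so that
  `D.critLocusGeom.pts` is DEFINITIONALLY `(Cubic.map (algebraMap F Fbar) E.twoTorsionPolynomial)
  .roots.toFinset`; the companion `D.critLocusAlgClosure : CriticalLocus (AlgebraicClosure F)` is the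
  reading in Mathlib's model (the row's literal text); all are identified by `critMap`.

Honest label: GENUINE MODEL PRESENTATION of print's object at the real datum, not a toy carrier;
count-neutral content of carrier C1 (RULINGS #316 (i)). Nothing here bears on the disputed parts of
the series; no side is taken on [IUTchIII] Cor. 3.12 or on any author; no abc claim. NOT here: the
`∞κ`-coric sets (GB-01), the local layer (GB-02), the base-change square (GB-03), clause (a) (GB-06),
and the (affine) effect of a Weierstrass `VariableChange` on the locus (not needed by the producer).
-/

noncomputable section

open Polynomial
open scoped Classical

universe u v w u' v'

namespace Literature.IUT.HodgeTheaters

namespace CriticalLocus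

/-! ## §1 Transport of a strictly critical locus along a field homomorphism -/

section Transport

variable {L : Type u} {L' : Type v} {L'' : Type w} [Field L] [Field L'] [Field L'']

/-- Two strictly critical loci over one field with the same point set are equal.
[claim: Mochizuki2012, status: disputed] -/
theorem ext_pts {S T : CriticalLocus L} (h : S.pts = T.pts) : S = T := by
  cases S; cases T; cases h; rfl

/-- **Transport of the strictly critical locus along a field homomorphism** `φ : L →+* L'`
(injective, as every field hom is): the three strictly critical points are moved by `φ` (memo
GAP-SIZING-B R4/R1 plumbing; abc-iut-inv-2's `GapSizingBSketch.critMap`). Intended: `F ↪ F̄`,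
`F̄ ↪ K̄_v` (base change of Rmk 3.1.7's locus from the global to the local model).
[claim: Mochizuki2012, status: disputed] -/
def critMap (S : CriticalLocus L) (φ : L →+* L') : CriticalLocus L' :=
  ⟨S.pts.map ⟨φ, φ.injective⟩, by rw [Finset.card_map]; exact S.card_eq⟩

variable (S : CriticalLocus L) (φ : L →+* L')

/-- The transported points are the `φ`-images (`Finset.map`). [claim: Mochizuki2012, status: disputed] -/
theorem critMap_pts : (S.critMap φ).pts = S.pts.map ⟨φ, φ.injective⟩ := rfl

/-- The transported points are the `φ`-images (`Finset.image`). [claim: Mochizuki2012, status: disputed] -/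
theorem critMap_pts_eq_image : (S.critMap φ).pts = S.pts.image φ := by
  rw [critMap_pts, Finset.map_eq_image]; rfl

/-- The transported points are the `φ`-images (sets). [claim: Mochizuki2012, status: disputed] -/
theorem coe_critMap_pts : ((S.critMap φ).pts : Set L') = φ '' (S.pts : Set L) := by
  rw [critMap_pts_eq_image, Finset.coe_image]

/-- Membership in the transported locus. [claim: Mochizuki2012, status: disputed] -/
theorem mem_critMap_pts {y : L'} : y ∈ (S.critMap φ).pts ↔ ∃ x ∈ S.pts, φ x = y := by
  rw [critMap_pts_eq_image, Finset.mem_image]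

/-- `φ x` is strictly critical after transport iff `x` was. [claim: Mochizuki2012, status: disputed] -/
theorem apply_mem_critMap_pts {x : L} : φ x ∈ (S.critMap φ).pts ↔ x ∈ S.pts := by
  rw [critMap_pts]
  exact Finset.mem_map' ⟨φ, φ.injective⟩

/-- Transport along the identity is the identity. [claim: Mochizuki2012, status: disputed] -/
theorem critMap_id : S.critMap (RingHom.id L) = S :=
  ext_pts (by rw [critMap_pts_eq_image]; exact Finset.image_id)

/-- Functoriality: transport along `φ` then `ψ` = along `ψ ∘ φ`. [claim: Mochizuki2012, status: disputed] -/
theorem critMap_critMap (ψ : L' →+* L'') : (S.critMap φ).critMap ψ = S.critMap (ψ.comp φ) :=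
  ext_pts (by simp only [critMap_pts_eq_image, Finset.image_image]; rfl)

end Transport

/-! ## §2 The strictly critical locus of an elliptic curve: the `2`-torsion abscissae -/

section TwoTorsion

variable {F : Type u} [Field F] {Ω : Type v} [Field Ω] {Ω' : Type w} [Field Ω']

/-- In characteristic `≠ 2` the leading coefficient `4` of the `2`-division cubic is nonzero
(private helper). [folklore] -/
private theorem twoTorsionPolynomial_a_ne_zero [NeZero (2 : F)] (E : WeierstrassCurve F) :
    E.twoTorsionPolynomial.a ≠ 0 := by
  change (4 : F) ≠ 0
  rw [show (4 : F) = 2 * 2 by norm_num]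
  exact mul_ne_zero two_ne_zero two_ne_zero

/-- **Rmk 3.1.7 (i), split case.** For a Weierstrass elliptic curve `E` over `F` (char `≠ 2`) and
`φ : F →+* Ω` along which the `2`-division cubic `4x³ + b₂x² + 2b₄x + b₆` splits: its three roots in
`Ω` — the abscissae of the points of order `2` = the strictly critical points of `|C|^cpt ≅ ℙ¹` in the
coordinate `x` (cusp at `∞`) — as a `CriticalLocus Ω`; three since `discr = 16·Δ_E ≠ 0`.
[claim: Mochizuki2012, status: disputed] -/
def ofTwoTorsionOfSplits [NeZero (2 : F)] (E : WeierstrassCurve F) [E.IsElliptic] (φ : F →+* Ω)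
    (hs : (E.twoTorsionPolynomial.toPoly.map φ).Splits) : CriticalLocus Ω :=
  ⟨(Cubic.map φ E.twoTorsionPolynomial).roots.toFinset,
    Cubic.card_roots_of_discr_ne_zero (twoTorsionPolynomial_a_ne_zero E) hs
      (E.twoTorsionPolynomial_discr_ne_zero_of_isElliptic (isUnit_iff_ne_zero.mpr two_ne_zero))⟩

/-- **Rmk 3.1.7 (i) over `L̄`.** For `E/F` elliptic (char `F ≠ 2`) and an ALGEBRAICALLY CLOSED field
`Ω` over `F` (print's `L̄`; the producer's `F̄`, `K̄_v`): the three `2`-torsion abscissae in `Ω` as a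
`CriticalLocus Ω` — the GEOMETRIC typing required by RULINGS #318. [claim: Mochizuki2012, status: disputed] -/
def ofTwoTorsion [NeZero (2 : F)] (E : WeierstrassCurve F) [E.IsElliptic] (Ω : Type v) [Field Ω]
    [Algebra F Ω] [IsAlgClosed Ω] : CriticalLocus Ω :=
  ofTwoTorsionOfSplits E (algebraMap F Ω) (IsAlgClosed.splits _)

variable [NeZero (2 : F)] (E : WeierstrassCurve F) [E.IsElliptic]

/-- The split-case points: the roots of the mapped cubic. [claim: Mochizuki2012, status: disputed] -/
theorem ofTwoTorsionOfSplits_pts (φ : F →+* Ω) (hs : (E.twoTorsionPolynomial.toPoly.map φ).Splits) :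
    (ofTwoTorsionOfSplits E φ hs).pts = (E.twoTorsionPolynomial.toPoly.map φ).roots.toFinset := by
  rw [← Cubic.map_toPoly]; rfl

/-- Split-case membership = being a root of the mapped cubic. [claim: Mochizuki2012, status: disputed] -/
theorem mem_pts_ofTwoTorsionOfSplits_iff (φ : F →+* Ω)
    (hs : (E.twoTorsionPolynomial.toPoly.map φ).Splits) (x : Ω) :
    x ∈ (ofTwoTorsionOfSplits E φ hs).pts ↔ (E.twoTorsionPolynomial.toPoly.map φ).IsRoot x := by
  rw [ofTwoTorsionOfSplits_pts, Multiset.mem_toFinset, mem_roots]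
  exact Polynomial.map_ne_zero (Cubic.ne_zero_of_a_ne_zero (twoTorsionPolynomial_a_ne_zero E))

/-- Split-case membership, as the printed equation `4x³ + φ(b₂)x² + 2φ(b₄)x + φ(b₆) = 0`.
[claim: Mochizuki2012, status: disputed] -/
theorem mem_pts_ofTwoTorsionOfSplits_iff_eq (φ : F →+* Ω)
    (hs : (E.twoTorsionPolynomial.toPoly.map φ).Splits) (x : Ω) :
    x ∈ (ofTwoTorsionOfSplits E φ hs).pts ↔
      4 * x ^ 3 + φ E.b₂ * x ^ 2 + 2 * φ E.b₄ * x + φ E.b₆ = 0 := by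
  rw [mem_pts_ofTwoTorsionOfSplits_iff, ← Cubic.map_toPoly]
  simp only [WeierstrassCurve.twoTorsionPolynomial, Cubic.map, Cubic.toPoly, map_ofNat, map_mul,
    IsRoot.def, eval_add, eval_mul, eval_C, eval_pow, eval_X, eval_ofNat]

/-- **Naturality (split case).** Transport along a further `ψ : Ω →+* Ω'` of the locus read along
`φ` is the locus read along `ψ ∘ φ` (Mathlib `Polynomial.Splits.roots_map`).
[claim: Mochizuki2012, status: disputed] -/
theorem critMap_ofTwoTorsionOfSplits (φ : F →+* Ω) (hs : (E.twoTorsionPolynomial.toPoly.map φ).Splits)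
    (ψ : Ω →+* Ω') :
    (ofTwoTorsionOfSplits E φ hs).critMap ψ =
      ofTwoTorsionOfSplits E (ψ.comp φ) (by rw [← Polynomial.map_map]; exact hs.map ψ) := by
  apply ext_pts
  rw [critMap_pts_eq_image, ofTwoTorsionOfSplits_pts, ofTwoTorsionOfSplits_pts,
    ← Polynomial.map_map, hs.roots_map ψ, Multiset.toFinset_map]

/-- The split-case locus depends on `φ` only (not on the splitting witness).
[claim: Mochizuki2012, status: disputed] -/
theorem ofTwoTorsionOfSplits_congr {φ φ' : F →+* Ω} (h : φ = φ')
    (hs : (E.twoTorsionPolynomial.toPoly.map φ).Splits)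
    (hs' : (E.twoTorsionPolynomial.toPoly.map φ').Splits) :
    ofTwoTorsionOfSplits E φ hs = ofTwoTorsionOfSplits E φ' hs' := by
  subst h; rfl

end TwoTorsion

section TwoTorsionGeom

variable {F : Type u} [Field F] [NeZero (2 : F)] (E : WeierstrassCurve F) [E.IsElliptic]
  (Ω : Type v) [Field Ω] [Algebra F Ω] {Ω' : Type w} [Field Ω']

/-- The geometric points: the roots in `Ω` of the `2`-division cubic. [claim: Mochizuki2012, status: disputed] -/
theorem ofTwoTorsion_pts [IsAlgClosed Ω] :
    (ofTwoTorsion E Ω).pts = (E.twoTorsionPolynomial.toPoly.map (algebraMap F Ω)).roots.toFinset :=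
  ofTwoTorsionOfSplits_pts E _ _

/-- The geometric points are EXACTLY the root set in `Ω` of the `2`-division cubic (the property
characterising the landed `CriticalLocus.exists_coe_pts_eq_rootSet_twoTorsion`).
[claim: Mochizuki2012, status: disputed] -/
theorem coe_pts_ofTwoTorsion [IsAlgClosed Ω] :
    ((ofTwoTorsion E Ω).pts : Set Ω) = E.twoTorsionPolynomial.toPoly.rootSet Ω := by
  rw [ofTwoTorsion_pts, rootSet_def, aroots_def]

/-- **Uniqueness.** A locus over `Ω` whose points are the root set of the `2`-division cubic IS
`ofTwoTorsion E Ω`; so the loci of the landed `exists_coe_pts_eq_rootSet_twoTorsion` /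
`exists_twoTorsion_rmk317ii` are this one. [claim: Mochizuki2012, status: disputed] -/
theorem eq_ofTwoTorsion_of_coe_pts_eq [IsAlgClosed Ω] (S : CriticalLocus Ω)
    (hS : (S.pts : Set Ω) = E.twoTorsionPolynomial.toPoly.rootSet Ω) : S = ofTwoTorsion E Ω :=
  ext_pts (Finset.coe_injective (by rw [hS, coe_pts_ofTwoTorsion]))

/-- Geometric membership is the printed equation `4x³ + b₂x² + 2b₄x + b₆ = 0` in `Ω` (the landed
`CriticalLocus.mem_pts_iff_of_coe_pts_eq`). [claim: Mochizuki2012, status: disputed] -/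
theorem mem_pts_ofTwoTorsion_iff [CharZero F] [IsAlgClosed Ω] (x : Ω) :
    x ∈ (ofTwoTorsion E Ω).pts ↔ 4 * x ^ 3 + algebraMap F Ω E.b₂ * x ^ 2 +
      2 * algebraMap F Ω E.b₄ * x + algebraMap F Ω E.b₆ = 0 :=
  mem_pts_iff_of_coe_pts_eq E _ (coe_pts_ofTwoTorsion E Ω) x

/-- Over a NUMBER FIELD `F` every geometric point is algebraic over `ℚ` (hypothesis of the landed
Rmk 3.1.7 (ii) dischargers; `CriticalLocus.isAlgebraic_of_coe_pts_eq`). [claim: Mochizuki2012, status: disputed] -/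
theorem isAlgebraic_of_mem_pts_ofTwoTorsion [NumberField F] [CharZero Ω] [IsAlgClosed Ω] :
    ∀ e ∈ (ofTwoTorsion E Ω).pts, IsAlgebraic ℚ e :=
  isAlgebraic_of_coe_pts_eq E _ (coe_pts_ofTwoTorsion E Ω)

/-- **Naturality along a ring hom over `F`.** If `ψ : Ω →+* Ω'` satisfies `ψ ∘ (F → Ω) = (F → Ω')`,
transporting the locus at `Ω` along `ψ` gives the locus at `Ω'` (e.g. `F̄ ↪ K̄_v`: the global locus
base-changes to the local one; `ClauseAGeom`'s target `critMap S B.φ`). [claim: Mochizuki2012, status: disputed] -/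
theorem critMap_ofTwoTorsion_ringHom [IsAlgClosed Ω] [Algebra F Ω'] [IsAlgClosed Ω'] (ψ : Ω →+* Ω')
    (hψ : ψ.comp (algebraMap F Ω) = algebraMap F Ω') :
    (ofTwoTorsion E Ω).critMap ψ = ofTwoTorsion E Ω' := by
  rw [ofTwoTorsion, critMap_ofTwoTorsionOfSplits]
  exact ofTwoTorsionOfSplits_congr E hψ _ _

/-- **Naturality along an `F`-algebra hom** `ψ : Ω →ₐ[F] Ω'` of algebraically closed fields.
[claim: Mochizuki2012, status: disputed] -/
theorem critMap_ofTwoTorsion [IsAlgClosed Ω] [Algebra F Ω'] [IsAlgClosed Ω'] (ψ : Ω →ₐ[F] Ω') :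
    (ofTwoTorsion E Ω).critMap (ψ : Ω →+* Ω') = ofTwoTorsion E Ω' :=
  critMap_ofTwoTorsion_ringHom E Ω (ψ : Ω →+* Ω') ψ.comp_algebraMap

end TwoTorsionGeom

end CriticalLocus

/-! ## §3 At initial Θ-data ([IUTchI] Def. 3.1): the locus of `E_F` over `F`, `F̄`, and any `Ω ⊇ F` -/

section Datum

open CriticalLocus

variable {F : Type u} {K : Type v} {Fbar : Type w} [Field F] [NumberField F] [Field K]
  [NumberField K] [Algebra F K] [Field Fbar] [Algebra F Fbar] [Algebra K Fbar]
  {E : WeierstrassCurve F} [E.IsElliptic] {l : ℕ} {P : BadPlacePredicates K}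
  (D : InitialThetaData F K Fbar E l P)

namespace InitialThetaData

include D

/-- **Def. 3.1 (b) ⇒ the `2`-division cubic of `E_F` SPLITS OVER `F`**: its roots in `F̄` are
`F`-rational (landed `InitialThetaData.exists_twoTorsion_roots`, from "the `2·3`-torsion points of
`E_F` are rational over `F`"), hence it splits over `F` (`Polynomial.Splits.of_splits_map`) — memo
R4: the datum's strictly critical points are `F`-rational. [claim: Mochizuki2012, status: disputed] -/
theorem twoTorsionPolynomial_splits : E.twoTorsionPolynomial.toPoly.Splits := by
  haveI := D.isAlgClosure
  haveI : IsAlgClosed Fbar := IsAlgClosure.isAlgClosed F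
  obtain ⟨e₁, e₂, e₃, h3⟩ := D.exists_twoTorsion_roots
  refine Splits.of_splits_map (algebraMap F Fbar) (IsAlgClosed.splits _) ?_
  intro a ha
  rw [← Cubic.map_toPoly, ← Cubic.roots, h3] at ha
  simp only [Multiset.insert_eq_cons, Multiset.mem_cons, Multiset.mem_singleton] at ha
  rcases ha with rfl | rfl | rfl <;> exact ⟨_, rfl⟩

/-- **The strictly critical locus of the datum's curve over `F` itself** (Rmk 3.1.7 (i), `L = F`;
memo R4 «`Ω := F` works»): the three `F`-rational `2`-torsion abscissae of `E_F`.
[claim: Mochizuki2012, status: disputed] -/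
def critLocus : CriticalLocus F :=
  ofTwoTorsionOfSplits E (RingHom.id F) (by rw [Polynomial.map_id]; exact D.twoTorsionPolynomial_splits)

/-- **The datum's strictly critical locus read in ANY field `Ω` over `F`** (`K`, `K_v`, `K̄_v`, …):
transport of `D.critLocus` along `F → Ω` (no algebraic closedness needed — the cubic splits over
`F`). [claim: Mochizuki2012, status: disputed] -/
def critLocusAt (Ω : Type u') [Field Ω] [Algebra F Ω] : CriticalLocus Ω :=
  D.critLocus.critMap (algebraMap F Ω)

/-- **GB-04, the RULED declaration — the GEOMETRIC strictly critical locus at the datum**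
(GAP-ITEMS.tsv row GB-04; memo §2 D1 (R4); RULINGS #318; L-of-record `Fbar` = the datum's OWN `F̄`,
Def. 3.1 (a), spec-keeper PIN L): the three `x`-coordinates of `E_F[2] ∖ {O}` in `F̄ = Fbar`,
`:= CriticalLocus.ofTwoTorsion E Fbar`, so `D.critLocusGeom.pts` is BY DEFINITION
`(Cubic.map (algebraMap F Fbar) E.twoTorsionPolynomial).roots.toFinset`. MODEL PRESENTATION at the
REAL datum (count-neutral, RULINGS #316 (i)). [claim: Mochizuki2012, status: disputed] -/
def critLocusGeom : CriticalLocus Fbar :=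
  haveI := D.isAlgClosure
  haveI : IsAlgClosed Fbar := IsAlgClosure.isAlgClosed F
  ofTwoTorsion E Fbar

/-- **Companion reading in Mathlib's model `AlgebraicClosure F`** (the row's literal text
`CriticalLocus (AlgebraicClosure D.F)`): `D.critLocus` read in `AlgebraicClosure F`
(`= ofTwoTorsion E _`; `critMap`-identified with `D.critLocusGeom`). [claim: Mochizuki2012, status: disputed] -/
def critLocusAlgClosure : CriticalLocus (AlgebraicClosure F) :=
  D.critLocusAt (AlgebraicClosure F)

/-- `D.critLocusAt Ω` is the split-case locus along `F → Ω`. [claim: Mochizuki2012, status: disputed] -/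
theorem critLocusAt_eq_ofTwoTorsionOfSplits (Ω : Type u') [Field Ω] [Algebra F Ω] :
    D.critLocusAt Ω = ofTwoTorsionOfSplits E (algebraMap F Ω)
      (D.twoTorsionPolynomial_splits.map (algebraMap F Ω)) := by
  rw [critLocusAt, critLocus, critMap_ofTwoTorsionOfSplits]
  exact ofTwoTorsionOfSplits_congr E ((algebraMap F Ω).comp_id) _ _

/-- In an ALGEBRAICALLY CLOSED `Ω ⊇ F`, `D.critLocusAt Ω = CriticalLocus.ofTwoTorsion E Ω`.
[claim: Mochizuki2012, status: disputed] -/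
theorem critLocusAt_eq_ofTwoTorsion (Ω : Type u') [Field Ω] [Algebra F Ω] [IsAlgClosed Ω] :
    D.critLocusAt Ω = ofTwoTorsion E Ω := by
  rw [critLocusAt_eq_ofTwoTorsionOfSplits]; rfl

/-- Membership in `D.critLocusAt Ω` is the printed cubic equation in `Ω`. [claim: Mochizuki2012, status: disputed] -/
theorem mem_pts_critLocusAt_iff (Ω : Type u') [Field Ω] [Algebra F Ω] (x : Ω) :
    x ∈ (D.critLocusAt Ω).pts ↔ 4 * x ^ 3 + algebraMap F Ω E.b₂ * x ^ 2 +
      2 * algebraMap F Ω E.b₄ * x + algebraMap F Ω E.b₆ = 0 := by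
  rw [critLocusAt_eq_ofTwoTorsionOfSplits, mem_pts_ofTwoTorsionOfSplits_iff_eq]

/-- Membership in `D.critLocus` is the printed cubic equation in `F`. [claim: Mochizuki2012, status: disputed] -/
theorem mem_pts_critLocus_iff (x : F) :
    x ∈ D.critLocus.pts ↔ 4 * x ^ 3 + E.b₂ * x ^ 2 + 2 * E.b₄ * x + E.b₆ = 0 := by
  rw [critLocus, mem_pts_ofTwoTorsionOfSplits_iff_eq]; rfl

/-- Transitivity at the datum: `D.critLocusAt Ω` transported along `ψ : Ω →+* Ω'` over `F` is
`D.critLocusAt Ω'` (e.g. `F̄ ↪ K̄_v`, `K ↪ K_v ↪ K̄_v`). [claim: Mochizuki2012, status: disputed] -/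
theorem critMap_critLocusAt (Ω : Type u') [Field Ω] [Algebra F Ω] (Ω' : Type v') [Field Ω']
    [Algebra F Ω'] (ψ : Ω →+* Ω') (hψ : ψ.comp (algebraMap F Ω) = algebraMap F Ω') :
    (D.critLocusAt Ω).critMap ψ = D.critLocusAt Ω' := by
  rw [critLocusAt, critLocusAt, critMap_critMap, hψ]

/-- The ruled locus IS `ofTwoTorsion E Fbar` (any `IsAlgClosed` instance). [claim: Mochizuki2012, status: disputed] -/
theorem critLocusGeom_eq_ofTwoTorsion [IsAlgClosed Fbar] : D.critLocusGeom = ofTwoTorsion E Fbar := rfl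

/-- The ruled locus' points, DEFINITIONALLY (the spec-keeper's explicit `pts`). [claim: Mochizuki2012, status: disputed] -/
theorem critLocusGeom_pts :
    D.critLocusGeom.pts = (Cubic.map (algebraMap F Fbar) E.twoTorsionPolynomial).roots.toFinset := rfl

/-- The ruled locus is the transport `D.critLocusAt Fbar` of the `F`-rational one along `F ↪ F̄`
(memo R4). [claim: Mochizuki2012, status: disputed] -/
theorem critLocusAt_eq_critLocusGeom : D.critLocusAt Fbar = D.critLocusGeom := by
  haveI := D.isAlgClosure
  haveI : IsAlgClosed Fbar := IsAlgClosure.isAlgClosed F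
  exact D.critLocusAt_eq_ofTwoTorsion Fbar

/-- The ruled locus' points = the root set of the cubic in `F̄` (so it is THE locus of the landed
`exists_coe_pts_eq_rootSet_twoTorsion` / `exists_twoTorsion_roots`). [claim: Mochizuki2012, status: disputed] -/
theorem coe_pts_critLocusGeom :
    (D.critLocusGeom.pts : Set Fbar) = E.twoTorsionPolynomial.toPoly.rootSet Fbar := by
  haveI := D.isAlgClosure
  haveI : IsAlgClosed Fbar := IsAlgClosure.isAlgClosed F
  exact coe_pts_ofTwoTorsion E Fbar

/-- Membership in the ruled locus is the printed equation in `F̄`. [claim: Mochizuki2012, status: disputed] -/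
theorem mem_pts_critLocusGeom_iff (x : Fbar) :
    x ∈ D.critLocusGeom.pts ↔ 4 * x ^ 3 + algebraMap F Fbar E.b₂ * x ^ 2 +
      2 * algebraMap F Fbar E.b₄ * x + algebraMap F Fbar E.b₆ = 0 := by
  rw [← critLocusAt_eq_critLocusGeom, mem_pts_critLocusAt_iff]

/-- **Transport of the ruled locus to any algebraically closed `Ω'` over `F`** along a ring hom over
`F` (e.g. `ι_v : F̄ ↪ K̄_v` of the base-change square) is the geometric locus at `Ω'` — the target
`critMap S B.φ` of `ClauseAGeom` at the datum. [claim: Mochizuki2012, status: disputed] -/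
theorem critMap_critLocusGeom {Ω' : Type v'} [Field Ω'] [Algebra F Ω'] [IsAlgClosed Ω']
    (ψ : Fbar →+* Ω') (hψ : ψ.comp (algebraMap F Fbar) = algebraMap F Ω') :
    D.critLocusGeom.critMap ψ = ofTwoTorsion E Ω' := by
  rw [← critLocusAt_eq_critLocusGeom, D.critMap_critLocusAt _ _ ψ hψ, critLocusAt_eq_ofTwoTorsion]

/-- The ruled locus is stable (as a set) under `G_F = Fbar ≃ₐ[F] Fbar`. [claim: Mochizuki2012, status: disputed] -/
theorem critMap_critLocusGeom_algEquiv (σ : Fbar ≃ₐ[F] Fbar) :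
    D.critLocusGeom.critMap (σ : Fbar →+* Fbar) = D.critLocusGeom := by
  rw [← critLocusAt_eq_critLocusGeom]
  exact D.critMap_critLocusAt _ _ _ (RingHom.ext fun x => σ.commutes x)

/-- The companion reading is `ofTwoTorsion E (AlgebraicClosure F)`. [claim: Mochizuki2012, status: disputed] -/
theorem critLocusAlgClosure_eq_ofTwoTorsion :
    D.critLocusAlgClosure = ofTwoTorsion E (AlgebraicClosure F) :=
  D.critLocusAt_eq_ofTwoTorsion _

/-- The two closures give the same locus up to transport: along ANY `F`-algebra hom
`AlgebraicClosure F → Fbar` (e.g. `IsAlgClosed.lift`), `D.critLocusAlgClosure ↦ D.critLocusGeom`.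
[claim: Mochizuki2012, status: disputed] -/
theorem critMap_critLocusAlgClosure_eq_critLocusGeom (ψ : AlgebraicClosure F →ₐ[F] Fbar) :
    D.critLocusAlgClosure.critMap (ψ : AlgebraicClosure F →+* Fbar) = D.critLocusGeom := by
  rw [critLocusAlgClosure, D.critMap_critLocusAt _ _ _ ψ.comp_algebraMap, critLocusAt_eq_critLocusGeom]

end InitialThetaData

end Datum

end Literature.IUT.HodgeTheaters
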